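/-
Origin: expansion seat `planner-pub-hodgecm-pv03-g8-0`, handover #3 2026-08-18T14:56:20Z (md5 f6498839) (`HOME/pub-hodgecm-pv03-g8/lean/Pv03g8/FactsLedger3.lean`, md5 f6498839, 294 lines);
landed by the gen-8 packager in gate run 31 as `HodgeCM/Model/ToyG2/FactsLedger3.lean` (verbatim).
-/
/-
Copyright: pub-hodgecm formalisation cell (harness21, 2026). New file (not vendored).
Origin: HOME/pub-hodgecm-pv03-g8/lean/Pv03g8/FactsLedger3.lean — session planner-pub-hodgecm-pv03-g8-0
(unit pub-hodgecm-pv03-g8, DAG-NODE PROVER #03 gen 8), row #3.  Intended final place: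
`HodgeCM/Model/ToyG2/FactsLedger3.lean` (module `HodgeCM.Model.ToyG2.FactsLedger3`; kind L5, consistency-witness layer).
ADDITIVE: nothing landed is edited; nothing imports it.  Imports are tree names only (no rewrite).
-/
import Mathlib
import Summits.HodgeConjecture.HodgeCM.Model.Toy.Isogeny
import Summits.HodgeConjecture.HodgeCM.Model.Toy.DegreeZero
import Summits.HodgeConjecture.HodgeCM.StubTree.Qw8Twist
import Summits.HodgeConjecture.HodgeCM.StubTree.Qw8MilnePosNoH0_2
import Summits.HodgeConjecture.HodgeCM.Proofs.Pohlmann.DegreeZeroGeneric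
import Summits.HodgeConjecture.HodgeCM.Proofs.Pohlmann.DegreeZeroDescent
import Summits.HodgeConjecture.HodgeCM.Proofs.Pohlmann.HodgeF0CM
import Summits.HodgeConjecture.HodgeCM.Proofs.Pohlmann.PohlmannNoN4
import Summits.HodgeConjecture.HodgeCM.Proofs.Pohlmann.WeightLines
import Summits.HodgeConjecture.HodgeCM.Model.ToyG2.CupFacts3
import Summits.HodgeConjecture.HodgeCM.Model.ToyG2.SplitAllGood
import Summits.HodgeConjecture.HodgeCM.Model.ToyG2.G4WitnessCM

/-!
# Ledger completeness for the universe of record: T1g, M42, E1a and the point-wise / CM-restricted facts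

toy-g4's ledger-completeness scan (HANDOFF item 3, 13:14Z) left seven recorded `Universe.Fact_*` candidates
UNDECIDED in the generation-2/3 universe of record `toyUniverse₃ d t = toyModel3With exteriorHodgeData traceSys (gplOf d t)`:
T1g `Fact_twistIsogeny`, E1a `Fact_weightLine` (`StubTree/Qw8Twist.lean`), M42 `Fact_H0_rank`
(`Proofs/Pohlmann/DegreeZeroGeneric.lean`), `Fact_weightSpanAt k` / `Fact_weightHodgeAt k` (M29 / M30 in one degree),
`Fact_hodge_F0_CM` / `Fact_pull_H0_CM` (N4 / N3 on CM abelian varieties), and `Fact_virtualCup11`.  This file decides all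
of them except `Fact_virtualCup11(₂)` (left open): they HOLD there, for every `d t`.

* §0 (general, any universe): **E1a `Fact_weightLine` is a THEOREM** of `ModelAxioms` + N1 + M42
  (`Universe.weightLine_of_H0_rank`; positive degrees: pohl-g3's `Universe.finrank_weightSpace_le_one`,
  `Proofs/Pohlmann/WeightLines.lean`; degree `0`: `dim_ℂ H⁰(A′, ℂ) = dim_ℚ H⁰(A′, ℚ) = 1`), and of the run-24 list
  `ModelAxioms` + N1 + N3 + `Fact_dimProd` + F7d (`Universe.weightLine_of_descentFacts`; degree `0` by qw8b-g3's
  `finrank_cohC_zero_le_one_of_descent`, `Proofs/Pohlmann/DegreeZeroDescent.lean`).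
* §1 (generation-1 exterior universe `toyModelWith D`, any Hodge datum): **T1g `Fact_twistIsogeny` holds**
  (`Toy.fact_twistIsogeny`): for `g ∈ Aut(K/ℚ)` with `Φ' = Φ ∘ g⁻¹`-as-typed, the lattice map `g` transported to
  `FK K` (`Toy.gF`) is a Hodge isomorphism `A_{(K,Φ')} → A_{(K,Φ)}` intertwining `ι_Φ(a)` with `ι_{Φ'}(g a)` — the toy
  proof of M25 `Toy.fact_conjIsogeny` (toy, `Model/Toy/Isogeny.lean`) with complex conjugation replaced by `g`
  (the eigenvector `g_ℂ(ε_τ)` has character `τ ∘ g⁻¹`, `Toy.gF_baseChange_eps_mem`).  No model witness of T1g existed.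
* §2 (generation-3, `toyModel3With D T pl`, any `D T pl` unless stated): T1g by transport along `Hom₂.ofHom` into the
  block-free `cmObj₂` (as M25 `fact3_conjIsogeny`); M42 (`⋀⁰` is a line, pohl-g5 `Toy.finrank_coh_zero`); N3-CM, N4-CM,
  M29-at-`k`, M30-at-`k`, E1a from §0; the same in pv03-g6's CM-good full sub-universe `toyUniverseCM d t` where the
  transport is `rfl` (T1g, M42).
* §3 `toyUniverse₃_factsLedger (d t)`: the seven decided facts jointly with `ModelAxioms` in the universe of record
  (pv03-g6 `toyUniverse₃_modelAxioms_all`, `SplitAllGood.lean`, no hypothesis on `d t`).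

Reading (FACTS.md P5 column / toy truth table): T1g, E1a, M42, M29ₖ, M30ₖ, N3-CM, N4-CM are TRUE in the universe of
record (E1a and M29ₖ/M30ₖ were theorems of facts already witnessed; T1g and M42 are new kernel witnesses); none of them is
a binder of a fact-level end state of record, so this is ledger completeness, not a consistency claim about an end state.
Kernel-proved from the tree; no citation, nothing posited.
-/

noncomputable section

open Literature.AlgebraicGeometry.Motives
open scoped TensorProduct

/-! ## §0 E1a `Fact_weightLine` is a theorem -/

namespace HodgeCM.Universe

variable {U : Universe}

/-- **E1a from `ModelAxioms` + N1 + M42**: `dim_ℂ V_S ≤ 1` in every degree — positive degrees by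
`Pohlmann.finrank_weightSpace_le_one`, degree `0` because `dim_ℂ H⁰(A′, ℂ) = dim_ℚ H⁰(A′, ℚ) = 1`. -/
theorem weightLine_of_H0_rank (M : U.ModelAxioms) (hN1 : U.Fact_cupExterior) (h42 : U.Fact_H0_rank) :
    U.Fact_weightLine := by
  intro F n Θ S k
  rcases Nat.eq_zero_or_pos k with rfl | hk
  · calc Module.finrank ℂ (U.weightSpace F Θ S 0)
        ≤ Module.finrank ℂ (U.CohC (U.cmProd F Θ) 0) := Submodule.finrank_le _
      _ = 1 := by rw [Module.finrank_baseChange, h42]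
  · exact finrank_weightSpace_le_one M hN1 hk S

/-- **E1a over the run-24 list** `ModelAxioms` + N1 + N3 + `Fact_dimProd` + F7d (degree `0` by
`finrank_cohC_zero_le_one_of_descent`). -/
theorem weightLine_of_descentFacts (M : U.ModelAxioms) (hN1 : U.Fact_cupExterior) (hN3 : U.Fact_pull_H0)
    (hd : U.Fact_dimProd) (h7d : U.Fact_gysinDescent) : U.Fact_weightLine := by
  intro F n Θ S k
  rcases Nat.eq_zero_or_pos k with rfl | hk
  · exact (Submodule.finrank_le _).trans (finrank_cohC_zero_le_one_of_descent M hN1 hN3 hd h7d)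
  · exact finrank_weightSpace_le_one M hN1 hk S

/-- M42 passes to any full sub-universe `restrictObj` (`Coh` inherited). -/
theorem restrictObj_fact_H0_rank {Q : U.Var → Prop} (hQ : U.SubClosed Q) (h : U.Fact_H0_rank) :
    (U.restrictObj Q hQ).Fact_H0_rank := fun X => h X.1

/-- T1g passes to any full sub-universe `restrictObj` (`cmAV`, `Mor`, `pull`, `cmAct` inherited). -/
theorem restrictObj_fact_twistIsogeny {Q : U.Var → Prop} (hQ : U.SubClosed Q) (h : U.Fact_twistIsogeny) :
    (U.restrictObj Q hQ).Fact_twistIsogeny := fun K Φ Φ' g hg => h K Φ Φ' g hg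

end HodgeCM.Universe

/-! ## §1 T1g in the generation-1 exterior universe -/

namespace HodgeCM.Toy

open Literature.AlgebraicGeometry.Motives.HodgeStructure (EndAction conj ofRat)
open exteriorPower CMPresentation

section twistIso

variable (K : CMField) (g : (K : Type) ≃ₐ[ℚ] (K : Type))

/-- `g ∈ Aut(K/ℚ)` transported to the presentation field `FK K` -/
def gF : FK K ≃ₐ[ℚ] FK K := ((eK K).symm.trans g).trans (eK K)

/-- (Ported verbatim from the HodgeCMPerL package; no docstring in the source.) -/
@[simp] lemma gF_eK (x : K) : gF K g (eK K x) = eK K (g x) := by simp [gF]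

/-- (Ported verbatim from the HodgeCMPerL package; no docstring in the source.) -/
@[simp] lemma gF_symm_eK (x : K) : (gF K g).symm (eK K x) = eK K (g.symm x) := by simp [gF]

/-- (Ported verbatim from the HodgeCMPerL package; no docstring in the source.) -/
lemma comp_gF_symm_comp_eK (τ : FK K →+* ℂ) :
    (τ.comp ((gF K g).symm : FK K →+* FK K)).comp (eK K : K →+* FK K)
      = (τ.comp (eK K : K →+* FK K)).comp (g.symm : K →+* K) := by
  ext x
  simp only [RingHom.comp_apply, RingHom.coe_coe]
  exact congrArg τ (gF_symm_eK K g x)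

/-- `g_ℂ (ε_τ)` is a joint eigenvector of character `τ ∘ g⁻¹`. -/
lemma gF_baseChange_eps_mem (τ : FK K →+* ℂ) :
    (gF K g : FK K →ₐ[ℚ] FK K).toLinearMap.baseChange ℂ (eps (FK K) τ)
      ∈ Submodule.span ℂ {eps (FK K) (τ.comp ((gF K g).symm : FK K →+* FK K))} := by
  apply mem_span_eps_of_eigen
  intro k
  have := tmul_mul_baseChange_algHom (gF K g : FK K →ₐ[ℚ] FK K) ((gF K g).symm k) (eps (FK K) τ)
  rw [show (gF K g : FK K →ₐ[ℚ] FK K) ((gF K g).symm k) = k from (gF K g).apply_symm_apply k, tmul_mul_eps,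
    map_smul] at this
  rw [this]
  rfl

variable (Φ Φ' : CMType K)

/-- the lattice map of the twist isogeny `A_{(K,Φ')} → A_{(K,Φ)}`: `g` on `Unit → FK K` -/
def gEquiv : (cmObj K Φ).L ≃ₗ[ℚ] (cmObj K Φ').L := LinearEquiv.piCongrRight fun _ : Unit => (gF K g).toLinearEquiv

/-- (Ported verbatim from the HodgeCMPerL package; no docstring in the source.) -/
lemma gEquiv_toLinearMap :
    (gEquiv K g Φ Φ').toLinearMap = (gF K g : FK K →ₐ[ℚ] FK K).toLinearMap.compLeft Unit := by
  refine LinearMap.ext fun v => funext fun u => ?_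
  rfl

/-- (Ported verbatim from the HodgeCMPerL package; no docstring in the source.) -/
lemma isHodge_gEquiv (h : ∀ φ : K →+* ℂ, φ ∈ Φ'.1 ↔ φ.comp (g : K →+* K) ∈ Φ.1) :
    Obj.IsHodge (X := cmObj K Φ') (Y := cmObj K Φ) (gEquiv K g Φ Φ').toLinearMap := by
  rw [Obj.isHodge_iff]
  rintro ⟨⟩ τ hτ
  rw [gEquiv_toLinearMap]
  change ((gF K g : FK K →ₐ[ℚ] FK K).toLinearMap.compLeft Unit).baseChange ℂ
      ((LinearMap.single ℚ (fun _ : Unit => (FK K : Type)) ()).baseChange ℂ (eps (FK K) τ)) ∈ _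
  rw [← LinearMap.comp_apply, ← LinearMap.baseChange_comp, compLeft_comp_single, LinearMap.baseChange_comp,
    LinearMap.comp_apply]
  obtain ⟨c, hc⟩ := Submodule.mem_span_singleton.mp (gF_baseChange_eps_mem K g τ)
  rw [← hc, map_smul]
  refine Submodule.smul_mem _ _ (Submodule.subset_span ⟨(), τ.comp ((gF K g).symm : FK K →+* FK K), ?_, rfl⟩)
  change (τ.comp ((gF K g).symm : FK K →+* FK K)).comp (eK K : K →+* FK K) ∈ Φ'.1
  rw [comp_gF_symm_comp_eK, h, RingHom.comp_assoc,
    show (g.symm : K →+* K).comp (g : K →+* K) = RingHom.id K from RingHom.ext fun x => g.symm_apply_apply x,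
    RingHom.comp_id]
  exact hτ

/-- the twist isogeny `u : A_{(K,Φ')} → A_{(K,Φ)}` (pull-back = `gEquiv`) -/
def gHom (h : ∀ φ : K →+* ℂ, φ ∈ Φ'.1 ↔ φ.comp (g : K →+* K) ∈ Φ.1) :
    Obj.Hom (cmObj K Φ') (cmObj K Φ) := ⟨(gEquiv K g Φ Φ').toLinearMap, isHodge_gEquiv K g Φ Φ' h⟩

/-- (Ported verbatim from the HodgeCMPerL package; no docstring in the source.) -/
lemma gEquiv_comp_mulK (a : K) :
    (gEquiv K g Φ Φ').toLinearMap ∘ₗ mulK K Φ a = mulK K Φ' (g a) ∘ₗ (gEquiv K g Φ Φ').toLinearMap := by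
  refine LinearMap.ext fun v => funext fun u => ?_
  simp [gEquiv, mulK, LinearMap.mulLeft_apply, Pi.mul_apply, map_mul]

variable (D : HodgeData)

/-- **T1g `Fact_twistIsogeny` holds in the exterior model `toyModelWith D`** (any Hodge datum), no hypothesis. -/
theorem fact_twistIsogeny : (toyModelWith D).Fact_twistIsogeny := by
  intro K Φ Φ' g h
  refine ⟨gHom K g Φ Φ' h, ?_, fun a => ?_⟩
  · change Function.Bijective (map 1 (gEquiv K g Φ Φ').toLinearMap)
    rw [map_one_eq]
    exact ((oneEquiv ℚ _).trans ((gEquiv K g Φ Φ').trans (oneEquiv ℚ _).symm)).bijective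
  · simp only [cmAction_ι]
    change map 1 (gEquiv K g Φ Φ').toLinearMap ∘ₗ map 1 (mulK K Φ a)
      = map 1 (mulK K Φ' (g a)) ∘ₗ map 1 (gEquiv K g Φ Φ').toLinearMap
    rw [← map_comp, ← map_comp, gEquiv_comp_mulK]

/-- T1g holds in `toyModel`. -/
theorem toyModel_fact_twistIsogeny : toyModel.Fact_twistIsogeny := fact_twistIsogeny exteriorHodgeData

end twistIso

end HodgeCM.Toy

/-! ## §2 The generation-3 universes `toyModel3With D T pl`, `toyUniverse₃ d t`, `toyUniverseCM d t` -/

namespace HodgeCM.ToyG2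

open HodgeCM.Toy Obj₂ HodgeCM.Universe

section anyData

variable (D : HodgeData) (T : TraceSys) (pl : GBlocks)

/-- **T1g in `toyModel3With D T pl`**: the generation-1 twist isogeny is a generation-3 morphism (block-free target). -/
theorem fact3_twistIsogeny : (toyModel3With D T pl).Fact_twistIsogeny := by
  intro K Φ Φ' g h
  obtain ⟨u, hu, hu'⟩ := HodgeCM.Toy.fact_twistIsogeny D K Φ Φ' g h
  exact ⟨Hom₂.ofHom u (isBlockFree_cmObj₂ K Φ), hu, hu'⟩

/-- **M42 in `toyModel3With D T pl`**: `dim_ℚ H⁰(X) = dim ⋀⁰ L_X = 1` for every (good) object. -/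
theorem fact3_H0_rank : (toyModel3With D T pl).Fact_H0_rank := fun X => HodgeCM.Toy.finrank_coh_zero D X.X.toObj

/-- N3 on CM abelian varieties, from N3 (`fact3_pull_H0`). -/
theorem fact3_pull_H0_CM : (toyModel3With D T pl).Fact_pull_H0_CM :=
  Universe.fact_pull_H0_CM_of_pull_H0 (fact3_pull_H0 D T pl)

end anyData

section exterior

variable (T : TraceSys) (pl : GBlocks)

/-- N4 on CM abelian varieties, from N4 (`fact3_hodge_F0`). -/
theorem fact3_hodge_F0_CM : (toyModel3With exteriorHodgeData T pl).Fact_hodge_F0_CM :=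
  Universe.fact_hodge_F0_CM_of_hodge_F0 (fact3_hodge_F0 T pl)

variable {T pl}

/-- M29 in every single degree (given the model axioms). -/
theorem toyModel3_weightSpanAt (M : (toyModel3With exteriorHodgeData T pl).ModelAxioms) (k : ℕ) :
    (toyModel3With exteriorHodgeData T pl).Fact_weightSpanAt k :=
  Universe.fact_weightSpanAt_of_weightSpan (toyModel3_weightSpan M) k

/-- M30 in every single degree (given the model axioms). -/
theorem toyModel3_weightHodgeAt (M : (toyModel3With exteriorHodgeData T pl).ModelAxioms) (k : ℕ) :
    (toyModel3With exteriorHodgeData T pl).Fact_weightHodgeAt k :=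
  Universe.weightHodge_iff_forall_weightHodgeAt.mp (toyModel3_weightHodge M) k

/-- **E1a `Fact_weightLine` in `toyModel3With exteriorHodgeData T pl`** (given the model axioms): §0 at N1 + M42. -/
theorem toyModel3_weightLine (M : (toyModel3With exteriorHodgeData T pl).ModelAxioms) :
    (toyModel3With exteriorHodgeData T pl).Fact_weightLine :=
  Universe.weightLine_of_H0_rank M (fact3_cupExterior exteriorHodgeData T pl) (fact3_H0_rank exteriorHodgeData T pl)

end exterior

/-! ### The universe of record and its CM-good sub-universe -/

section record

variable (d t : ℚ)

/-- (Ported verbatim from the HodgeCMPerL package; no docstring in the source.) -/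
theorem toyUniverse₃_fact_twistIsogeny : (toyUniverse₃ d t).Fact_twistIsogeny := fact3_twistIsogeny _ _ _

/-- (Ported verbatim from the HodgeCMPerL package; no docstring in the source.) -/
theorem toyUniverse₃_fact_H0_rank : (toyUniverse₃ d t).Fact_H0_rank := fact3_H0_rank _ _ _

/-- (Ported verbatim from the HodgeCMPerL package; no docstring in the source.) -/
theorem toyUniverse₃_fact_weightLine : (toyUniverse₃ d t).Fact_weightLine :=
  toyModel3_weightLine (toyUniverse₃_modelAxioms_all d t)

/-- (Ported verbatim from the HodgeCMPerL package; no docstring in the source.) -/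
theorem toyUniverse₃_fact_hodge_F0_CM : (toyUniverse₃ d t).Fact_hodge_F0_CM := fact3_hodge_F0_CM _ _

/-- (Ported verbatim from the HodgeCMPerL package; no docstring in the source.) -/
theorem toyUniverse₃_fact_pull_H0_CM : (toyUniverse₃ d t).Fact_pull_H0_CM := fact3_pull_H0_CM _ _ _

/-- (Ported verbatim from the HodgeCMPerL package; no docstring in the source.) -/
theorem toyUniverse₃_fact_weightSpanAt (k : ℕ) : (toyUniverse₃ d t).Fact_weightSpanAt k :=
  toyModel3_weightSpanAt (toyUniverse₃_modelAxioms_all d t) k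

/-- (Ported verbatim from the HodgeCMPerL package; no docstring in the source.) -/
theorem toyUniverse₃_fact_weightHodgeAt (k : ℕ) : (toyUniverse₃ d t).Fact_weightHodgeAt k :=
  toyModel3_weightHodgeAt (toyUniverse₃_modelAxioms_all d t) k

/-- T1g in the CM-good universe `toyUniverseCM d t` (`restrictObj`, transport `rfl`). -/
theorem toyUniverseCM_fact_twistIsogeny : (toyUniverseCM d t).Fact_twistIsogeny :=
  Universe.restrictObj_fact_twistIsogeny _ (toyUniverse₃_fact_twistIsogeny d t)

/-- M42 in the CM-good universe `toyUniverseCM d t`. -/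
theorem toyUniverseCM_fact_H0_rank : (toyUniverseCM d t).Fact_H0_rank :=
  Universe.restrictObj_fact_H0_rank _ (toyUniverse₃_fact_H0_rank d t)

/-! ## §3 The ledger bundle -/

/-- **Ledger completeness in the universe of record** (every `d t`): the model axioms together with T1g, M42, E1a,
N4-CM, N3-CM, and M29 / M30 in every single degree. -/
theorem toyUniverse₃_factsLedger :
    (toyUniverse₃ d t).ModelAxioms ∧ (toyUniverse₃ d t).Fact_twistIsogeny ∧ (toyUniverse₃ d t).Fact_H0_rank ∧
      (toyUniverse₃ d t).Fact_weightLine ∧ (toyUniverse₃ d t).Fact_hodge_F0_CM ∧ (toyUniverse₃ d t).Fact_pull_H0_CM ∧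
      (∀ k, (toyUniverse₃ d t).Fact_weightSpanAt k) ∧ (∀ k, (toyUniverse₃ d t).Fact_weightHodgeAt k) :=
  ⟨toyUniverse₃_modelAxioms_all d t, toyUniverse₃_fact_twistIsogeny d t, toyUniverse₃_fact_H0_rank d t,
    toyUniverse₃_fact_weightLine d t, toyUniverse₃_fact_hodge_F0_CM d t, toyUniverse₃_fact_pull_H0_CM d t,
    toyUniverse₃_fact_weightSpanAt d t, toyUniverse₃_fact_weightHodgeAt d t⟩

/-- The new witnesses packaged: a universe with the model axioms, T1g, M42 and E1a. -/
theorem exists_model_twistIsogeny_H0_rank_weightLine :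
    ∃ U : Universe, U.ModelAxioms ∧ U.Fact_twistIsogeny ∧ U.Fact_H0_rank ∧ U.Fact_weightLine :=
  ⟨toyUniverse₃ 1 4, toyUniverse₃_modelAxioms_all 1 4, toyUniverse₃_fact_twistIsogeny 1 4,
    toyUniverse₃_fact_H0_rank 1 4, toyUniverse₃_fact_weightLine 1 4⟩

end record

end HodgeCM.ToyG2
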